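/-
Origin: expansion seat `planner-pub-hodgecm-pv01-g3-0`, handover #2 2026-08-18T05:55:43Z (`HOME/pub-hodgecm-pv01-g3/lean/Pv01g3/Li92VacuityLeaves.lean`, md5 8693ab4f, 92 lines);
landed by the gen-6 packager in gate run 24 as `HodgeCM/PerL34/Li92VacuityLeaves.lean` (import ^import Pv[0-9]+g[0-9]+\.→import HodgeCM.PerL34. ×1).
-/
/-
pub-hodgecm cell — DAG-NODE PROVER #01 gen 3 (session planner-pub-hodgecm-pv01-g3-0, unit pub-hodgecm-pv01-g3).
`Li92VacuityLeaves`: the non-triviality price `hNT` / `CharsSeeVector T` of the boundary witnesses (`Li92Vacuity`,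
and the carver's seam-S3 witness `SeamVacuity.clusterOutputs_iff_open_chars`) is PAID BY THE TOP THEOREM'S OWN
BINDERS — no mathematics of PerL beyond what is landed, nothing posited, nothing cited.
In every good context the `L²` function `emb_Γ(ω₁ ∪ ω₂)` of a non-zero wedge of theta one-forms is a non-zero
vector of `L²([G_U]) = T.HG L ι₁ V` (landed: `ThetaModel.emb_ne_zero` = Petersson `Fact_innerEmb` (N09b) +
Hodge–Riemann (2,0) `Fact_hodgeRiemann20` (N07); holomorphy of theta one-forms `Open_thetaSub` (N12a) +
`Universe.Uiso_le_H10` + `cup2C_mem_F2` (`ModelAxioms`)); and a non-zero wedge in every good context is exactly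
node N33 `Open_thetaWedge`, which the carver's `AssemblyRoutes.N33_wedge_of_weil_chars` derives from `Open_chars` +
pv03's `WeilStepsInput`.  HENCE, with the binders `(M, h07, h09b, hM38, hAlb, hW)` that
`Li92Route.perL_of_li92PrintWeilLeaves` / `AssemblyRoutes.perL_of_openCharsWeilLeaves` /
`AssemblyWeil.perL_of_weilDictLeaves` ALREADY CARRY, the three N31-side records are equivalent to the open input
with NO further hypothesis:
  `PrintInputs T ↔ T.Open_chars`, `AnalyticInputs T ↔ T.Open_chars`, `ClusterOutputs T ↔ T.Open_chars`
(`printInputs_iff_open_chars_of_leaves`, `analyticInputs_iff_open_chars_of_leaves`,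
`clusterOutputs_iff_open_chars_of_leaves`).  Reading (for referees, not an objection): inside those end-state
theorems the binder `hP` (route B) / `h31` (route A, S3) is interchangeable with `hch : T.Open_chars` on the nose;
what the records add is the TARGET TYPE of an honest instantiation, never logical strength.
Imports: this seat's `Pv01g3.Li92Vacuity` (run-24 queue; rename to `HodgeCM.PerL34.Li92Vacuity`) and the landed
`HodgeCM.PerL34.Li92PerL` (pv13-g2, run 22; brings `AssemblyRoutes`).  Proposed place:
`HodgeCM/PerL34/Li92VacuityLeaves.lean`; six new theorems in `HodgeCM.PerL34.Li92Route` (no clash with the tree).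
-/
import Summits.HodgeConjecture.HodgeCM.PerL34.Li92Vacuity
import Summits.HodgeConjecture.HodgeCM.PerL34.Li92PerL

/-! PORT of `HodgeCM/PerL34/Li92VacuityLeaves.lean` (HodgeCMPerL run 82) — verbatim mechanical port; provenance in the PORT header line. -/

set_option autoImplicit false

noncomputable section

namespace HodgeCM
namespace PerL34
namespace Li92Route

variable {U : Universe} (T : U.ThetaModel)

/-- **A non-zero `L²` vector from a non-zero theta wedge** (kernel over landed lemmas): in a good context, if
`ω₁ ∪ ω₂ ≠ 0` for theta one-forms `ω₁ ∈ Θ₀(Γ)`, `ω₂ ∈ Θ₁(Γ)` (holomorphic by `Open_thetaSub`), then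
`emb_Γ(ω₁ ∪ ω₂) ≠ 0` in `L²([G_U])` (`ThetaModel.emb_ne_zero`: Petersson + Hodge–Riemann (2,0)). -/
theorem exists_ne_zero_of_thetaWedge (M : U.ModelAxioms) (hHR : U.Fact_hodgeRiemann20) (hI : T.Fact_innerEmb)
    (hsub : T.Open_thetaSub) (hw : T.Open_thetaWedge)
    {L : CMField} {ι₁ : L →+* ℂ} (V : HermSpace3 L ι₁) (c : SeesawCtx L) (hc : T.GoodCtx ι₁ c) :
    ∃ x : T.HG L ι₁ V, x ≠ 0 := by
  obtain ⟨Γ, ω₁, h₁, ω₂, h₂, hne⟩ := hw V c hc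
  have h10 : ∀ (i : Fin 4) {ω : U.CohC (U.pms L ι₁ V Γ) 1}, ω ∈ T.Theta V c i Γ →
      ω ∈ U.H10 (U.pms L ι₁ V Γ) :=
    fun i _ hω => U.Uiso_le_H10 M.pull_hodge Γ c.K (c.Ψ i) c.σ (hsub V c hc i Γ hω)
  exact ⟨_, T.emb_ne_zero M hI hHR Γ (Universe.cup2C_mem_F2 M _ (h10 0 h₁) (h10 1 h₂)) hne⟩

/-- Hence `CharsSeeVector T` (indeed a non-zero vector in EVERY good context) from N07, N09b, N12a, N33. -/
theorem charsSeeVector_of_thetaWedge (M : U.ModelAxioms) (hHR : U.Fact_hodgeRiemann20) (hI : T.Fact_innerEmb)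
    (hsub : T.Open_thetaSub) (hw : T.Open_thetaWedge) : CharsSeeVector T :=
  fun V c hc _ => exists_ne_zero_of_thetaWedge T M hHR hI hsub hw V c hc

/-- **The price paid by the top theorem's binders**: `CharsSeeVector T` from `(M, h07, h09b, hM38, hAlb)` together
with `hch` and `hW` (N33 by the carver's `N33_wedge_of_weil_chars`, N12a by `N12a_thetaSub_of_split`). -/
theorem charsSeeVector_of_leaves (M : U.ModelAxioms) (h07 : N07_hodgeRiemann20 U) (h09b : N09b_innerEmb T)
    (hM38 : U.Fact_cmInflation) (hAlb : T.Fact_thetaAlbanese) (hch : T.Open_chars)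
    (hW : CharSpansWeil.WeilStepsInput T) : CharsSeeVector T :=
  charsSeeVector_of_thetaWedge T M ((N07_iff U).mp h07) ((N09b_iff T).mp h09b)
    ((N12a_iff T).mp (N12a_thetaSub_of_split M T hM38 hAlb)) ((N33_iff T).mp (AssemblyRoutes.N33_wedge_of_weil_chars T hch hW))

/-- **ROUTE B, inside the end-state theorem**: with the other binders of `perL_of_li92PrintWeilLeaves` in hand,
`hP : PrintInputs T` and `hch : T.Open_chars` are interchangeable — no `hNT`, no further hypothesis. -/
theorem printInputs_iff_open_chars_of_leaves (M : U.ModelAxioms) (h07 : N07_hodgeRiemann20 U)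
    (h09b : N09b_innerEmb T) (hM38 : U.Fact_cmInflation) (hAlb : T.Fact_thetaAlbanese)
    (hW : CharSpansWeil.WeilStepsInput T) : PrintInputs T ↔ T.Open_chars :=
  ⟨open_chars_of_print T, fun hch =>
    (printInputs_iff T).mpr ⟨hch, charsSeeVector_of_leaves T M h07 h09b hM38 hAlb hch hW⟩⟩

/-- **ROUTE A, inside the end-state theorem**: likewise `AnalyticInputs T ↔ T.Open_chars`. -/
theorem analyticInputs_iff_open_chars_of_leaves (M : U.ModelAxioms) (h07 : N07_hodgeRiemann20 U)
    (h09b : N09b_innerEmb T) (hM38 : U.Fact_cmInflation) (hAlb : T.Fact_thetaAlbanese)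
    (hW : CharSpansWeil.WeilStepsInput T) : AnalyticInputs T ↔ T.Open_chars :=
  ⟨open_chars_of_analytic T, fun hch =>
    (analyticInputs_iff T).mpr ⟨hch, charsSeeVector_of_leaves T M h07 h09b hM38 hAlb hch hW⟩⟩

/-- **SEAM S3, inside the end-state theorem** (sharpening the carver's `clusterOutputs_iff_open_chars (hNT)`): with
the binders of `AssemblyWeil.perL_of_weilDictLeaves` / `perL_of_clusterWeilLeaves` in hand, `h31 : ClusterOutputs T`
and `hch : T.Open_chars` are interchangeable — the junk `SideOutputs` is route A's `AnalyticSide.toSideOutputs` of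
the junk `AnalyticSide` (`clusterOutputs_of_analytic`). -/
theorem clusterOutputs_iff_open_chars_of_leaves (M : U.ModelAxioms) (h07 : N07_hodgeRiemann20 U)
    (h09b : N09b_innerEmb T) (hM38 : U.Fact_cmInflation) (hAlb : T.Fact_thetaAlbanese)
    (hW : CharSpansWeil.WeilStepsInput T) : ClusterOutputs T ↔ T.Open_chars :=
  ⟨open_chars_of_cluster T, fun hch =>
    clusterOutputs_of_analytic T ((analyticInputs_iff_open_chars_of_leaves T M h07 h09b hM38 hAlb hW).mpr hch)⟩

end Li92Route
end PerL34
end HodgeCM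

end
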